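import Summits.BirchSwinnertonDyer.BirchSwinnertonDyer.Theses.ShaPrimaryTransfer
import Literature.NumberTheory.EllipticCurves.XCubeAdd1110085SqThreeDescent
import Literature.NumberTheory.EllipticCurves.XCubeAdd2465SqThreeDescent

/-!
# BirchSwinnertonDyer / ShaPrimaryTransfer — crux `FiniteShaComponentTransfer` (stmt-BirchSwinnertonDyer-22356):
# THE DOOR AT 3 AT RANK 4 — `t_3 = 0`, `corank Sel_{3^∞} = rank = 4` for `y² = x³ − 27·1110085²`, by `3`-descent alone;
# the door-at-3 ladder through rank 4

Route `ShaPrimaryTransfer` (D-0145 LINE 2): T = `FiniteShaComponentTransfer` (stmt-22356), O = `OneFiniteShaComponent`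
(stmt-22357). Sequel of `ShaPrimaryTransferFiniteShaComponentTransferDoorAtThreeRankThree.lean` (prover seat `bsd-line-spt-p1`
g7, `--supports stmt-22356 --as helper`). With the closure form of the class-wide sharpness criterion
(`MordellT.door_at_three_of_closure`, tree `XCubeAddTSqThreeDescent.lean` §5) and the instance
`t = 1110085 = 5·53·59·71` (tree `XCubeAdd1110085SqThreeDescent.lean`: the `243`-class box `⟨[2],[5],[53],[59],[71]⟩` is
generated by the descent values of eight rational points, found after ranking the candidates `t` by a Mestre–Nagao sum):

* §1 **the door at 3 at RANK 4**, UNCONDITIONAL: `E : y² = x³ − 27·1110085²` has `rank E(ℚ) = 4`, `Ш(E/ℚ)[3^∞] = 0`,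
  `t_3(E) = 0`, `corank_{ℤ₃} Sel_{3^∞}(E/ℚ) = 4` (`door_at_three_rank_four`, `exists_door_at_three_rank_four`,
  `oneFiniteShaComponent_1110085`); `rank(y² = x³ + 1110085²)(ℚ) = 4`;
* §2 **the door-at-3 ladder**: for every `r ≤ 4` with `2 ≤ r` an elliptic curve over `ℚ` of rank `r` with `t_3 = 0` and
  `corank Sel_{3^∞} = r`, by `3`-descent alone (`exists_door_at_three_of_le_four`; ranks `2, 3, 4` from `t = 55` (g6),
  `2465`, `1110085`) — next to the `2`-descent ladder through rank `7` at `p₀ = 2` (g5);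
* §3 the cell `(E, 3, q)` read through T BY NAME (`shaCorank_1110085_eq_zero_of_transfer`,
  `selmerCorank_1110085_eq_four_of_transfer`).

Nothing here proves T, O or BSD; T remains conjecture-grade at rank ≥ 2. References: K. Jeong, Proc. Japan Acad. 95
(2019), §3; H. Cohen, F. Pazuki, Acta Arith. 140 (2009), Thm. 2.1; J.-F. Mestre, Compositio Math. 58 (1986) (the sums);
R. Greenberg, LNM 1716 (1999), §1.
-/

-- D-0017: single-problem summit, so `Summit.BirchSwinnertonDyer.BirchSwinnertonDyer.…` repeats a namespace BY DESIGN.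
set_option linter.dupNamespace false

noncomputable section

namespace Summit.BirchSwinnertonDyer.BirchSwinnertonDyer.Theorems.ShaPrimaryTransferDoorAtThreeRankFour

open scoped Classical
open Literature.NumberTheory.EllipticCurves
open WeierstrassCurve
open Summit.BirchSwinnertonDyer.BirchSwinnertonDyer.Theses.ShaPrimaryTransfer (FiniteShaComponentTransfer OneFiniteShaComponent)

/-! ## §1 The door at 3 at rank 4: `E : y² = x³ − 27·1110085²` -/

/-- **THE DOOR AT 3 AT RANK 4: `rank E(ℚ) = 4` and `t_3(E) = corank_{ℤ₃} Ш(E/ℚ)[3^∞] = 0`** for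
`E : y² = x³ − 27·1110085²` — UNCONDITIONAL (complete `√−3`-descent over `ℚ(ζ₃)`; tree `Mordell1110085`).
[cite: Jeong2019RankExactlyTwoII, Prop. 3.5] [cite: CohenPazuki2009, Thm. 2.1] -/
theorem door_at_three_rank_four :
    (mordellCurve (-27 * ((1110085 : ℕ) : ℚ) ^ 2)).mordellWeilRank = 4 ∧
      (mordellCurve (-27 * ((1110085 : ℕ) : ℚ) ^ 2)).shaCorank 3 = 0 :=
  ⟨Mordell1110085.mordellWeilRank_curve.2, Mordell1110085.shaCorank_three⟩

/-- **`rank(y² = x³ + 1110085²)(ℚ) = 4`** (Jeong's model `A_t`). [cite: Jeong2019RankExactlyTwoII, Prop. 3.5] -/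
theorem mordellWeilRank_1110085 : (mordellCurve (((1110085 : ℕ) : ℚ) ^ 2)).mordellWeilRank = 4 :=
  Mordell1110085.mordellWeilRank_curve.1

/-- **`corank_{ℤ₃} Sel_{3^∞}(E/ℚ) = rank E(ℚ) = 4`** — T's hypothesis in Selmer coordinates at `p = 3`, rank `4`.
[cite: Greenberg1999LNM, §1 pp. 54–57] -/
theorem selmerCorank_three_eq_rank :
    (mordellCurve (-27 * ((1110085 : ℕ) : ℚ) ^ 2)).selmerCorank 3 = 4 ∧
      (mordellCurve (-27 * ((1110085 : ℕ) : ℚ) ^ 2)).selmerCorank 3 =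
        (mordellCurve (-27 * ((1110085 : ℕ) : ℚ) ^ 2)).mordellWeilRank :=
  ⟨Mordell1110085.selmerCorank_three, by rw [Mordell1110085.selmerCorank_three, Mordell1110085.mordellWeilRank_curve.2]⟩

/-- **O holds for `E`** (rank 4), with witness the odd prime `p₀ = 3`. UNCONDITIONAL. [cite: CohenPazuki2009, Thm. 2.1] -/
theorem oneFiniteShaComponent_1110085 :
    ∃ (p : ℕ) (_ : Fact p.Prime), (mordellCurve (-27 * ((1110085 : ℕ) : ℚ) ^ 2)).shaCorank p = 0 :=
  ⟨3, ⟨Nat.prime_three⟩, Mordell1110085.shaCorank_three⟩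

/-- **Existence form**: there is an elliptic curve over `ℚ` of Mordell–Weil rank `4` whose door at `3` is open —
`t_3 = 0`, `Ш[3^∞] = 0`, `corank Sel_{3^∞} = 4` — certified by descent at `3` alone. [cite: Jeong2019RankExactlyTwoII, Prop. 3.5] -/
theorem exists_door_at_three_rank_four :
    ∃ W : WeierstrassCurve ℚ, W.IsElliptic ∧ W.mordellWeilRank = 4 ∧ W.shaCorank 3 = 0 ∧
      AddCommGroup.primaryComponent W.sha 3 = ⊥ ∧ W.selmerCorank 3 = 4 :=
  ⟨mordellCurve (-27 * ((1110085 : ℕ) : ℚ) ^ 2), Mordell1110085.isElliptic_curve, Mordell1110085.mordellWeilRank_curve.2,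
    Mordell1110085.shaCorank_three, Mordell1110085.primaryComponent_sha_three, Mordell1110085.selmerCorank_three⟩

/-! ## §2 The door-at-3 ladder through rank 4 -/

/-- **The door-at-3 ladder**: for every `2 ≤ r ≤ 4` an elliptic curve over `ℚ` of Mordell–Weil rank EXACTLY `r` with
`t_3 = 0` and `corank_{ℤ₃} Sel_{3^∞} = r`, certified by `√−3`-descent alone (`t = 55, 2465, 1110085`).
[cite: Jeong2019RankExactlyTwoII, Prop. 3.5] -/
theorem exists_door_at_three_of_le_four (r : ℕ) (h2 : 2 ≤ r) (h4 : r ≤ 4) :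
    ∃ W : WeierstrassCurve ℚ, W.IsElliptic ∧ W.mordellWeilRank = r ∧ W.shaCorank 3 = 0 ∧ W.selmerCorank 3 = r := by
  rcases Nat.lt_or_ge r 4 with hlt | hge
  · rcases Nat.lt_or_ge r 3 with hlt3 | hge3
    · have hr : r = 2 := by omega
      subst hr
      exact ⟨mordellCurve (-81675 : ℚ), XCubeSub81675.isElliptic_curve, XCubeSub81675.mordellWeilRank_curve,
        XCubeSub81675.shaCorank_three, XCubeSub81675.selmerCorank_three⟩
    · have hr : r = 3 := by omega
      subst hr
      exact ⟨mordellCurve (-27 * ((2465 : ℕ) : ℚ) ^ 2), Mordell2465.isElliptic_curve, Mordell2465.mordellWeilRank_curve.2,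
        Mordell2465.shaCorank_three, Mordell2465.selmerCorank_three⟩
  · have hr : r = 4 := by omega
    subst hr
    exact ⟨mordellCurve (-27 * ((1110085 : ℕ) : ℚ) ^ 2), Mordell1110085.isElliptic_curve,
      Mordell1110085.mordellWeilRank_curve.2, Mordell1110085.shaCorank_three, Mordell1110085.selmerCorank_three⟩

/-! ## §3 The cell `(E, 3, q)` read through T (the crux BY NAME) -/

/-- **T at the rank-4 door at 3**: granting T, `t_q(E) = 0` at EVERY prime `q` (unconditional at `q = 3`; at `q ≠ 3`
exactly what T asserts — no instrument in the tree decides e.g. `t_2(E)`). [cite: CohenPazuki2009, Thm. 2.1] -/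
theorem shaCorank_1110085_eq_zero_of_transfer (hT : FiniteShaComponentTransfer) (q : ℕ) [Fact q.Prime] :
    (mordellCurve (-27 * ((1110085 : ℕ) : ℚ) ^ 2)).shaCorank q = 0 :=
  haveI := Mordell1110085.isElliptic_curve
  haveI : Fact (Nat.Prime 3) := ⟨Nat.prime_three⟩
  hT _ 3 q Mordell1110085.shaCorank_three

/-- **T ⟹ `corank_{ℤ_q} Sel_{q^∞}(E/ℚ) = 4` at every prime `q`** (Greenberg's identity `corank Sel_{q^∞} = rank + t_q`).
[cite: Greenberg1999LNM, §1 pp. 54–57] -/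
theorem selmerCorank_1110085_eq_four_of_transfer (hT : FiniteShaComponentTransfer) (q : ℕ) [Fact q.Prime] :
    (mordellCurve (-27 * ((1110085 : ℕ) : ℚ) ^ 2)).selmerCorank q = 4 := by
  haveI := Mordell1110085.isElliptic_curve
  rw [(mordellCurve (-27 * ((1110085 : ℕ) : ℚ) ^ 2)).selmerCorank_eq_mordellWeilRank_add_holds q,
    Mordell1110085.mordellWeilRank_curve.2, shaCorank_1110085_eq_zero_of_transfer hT q]

end Summit.BirchSwinnertonDyer.BirchSwinnertonDyer.Theorems.ShaPrimaryTransferDoorAtThreeRankFour
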